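import Literature.NumberTheory.EllipticCurves.Kato2004.AdditiveNoSplitCyclotomicTwistRankZeroShaUpperBoundFineSelmerAtTwoSharp
import HarnessLib

/-!
# Kato 2004 at `p = 2`: the twist by `−2` (sequel of `AdditiveNoSplitCyclotomicTwistRankZeroShaUpperBoundFineSelmerAtTwoSharp.lean`, same seat, same GEN) — the local term IS met by step T3, with length `1` at a prime `𝔮'` with `v₂(𝔮'(0)) = 1`; the bound `+ 1` under the hypothesis «no split multiplicative twist by `−1` at `2`»

WHY. For an additive `E` with `E^{(−2)}` split multiplicative at `2` (`E ≅ E_q ⊗ χ_{−2}` over `ℚ₂`; census: 39 classes) T16 (a)–(c)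
locate Kato's local term at `𝔭' = ker(κ^{−1}χ_{−2})` (lattice `T₂E`), a «`c = +1`» prime (`χ_{−2}(σ_{−1}) = −1`): it IS one of the
primes `𝔭₊(𝔮')` of step T3, `𝔮' := 𝔭' ∩ Λ'`. This file (kept separate for the 400-line cap; it continues that file's T15–T16 numbering)
records what the SAME fourteen steps give then: the count loses exactly
`v₂(𝔮'(0)) = 1`, i.e. the conclusion holds with `+ 1`. ONE named fact (`def … : Prop`): hypothesis (NST″) «`W^{(−1)}` is not split
multiplicative at `2`» (so: all additive curves except those with `E^{(−1)}` split multiplicative, census 169 classes, where the same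
argument gives `+ 2` — not claimed), conclusion `… ≤ ord₂ q + 1`. On the curves satisfying (NST′) it is implied by that file's APPEND fact `…_of_noSplitTwistNegOneNegTwo_…`
(pure logic, Summits-side); its content is the `E^{(−2)}`-split case. Summits-side the `+ 1` is removed by Cassels–Tate squareness when
`ord₂ #Ш_an` is even (GEN 5's `…_of_even` mechanism, `padicValNat_le_two_mul_of_isSquare_of_le_succ`). Flag for the referee (audit with
the two facts above): `Kato-12.5(3)-(12.5.1)-13.13-T3-T6-at-two-additive-noSplitTwistNegOne-irreducible-fineSelmer-fg-plus-one`.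

* **T17 (a) (where the local term sits, from T16).** `E` additive at `2` with `E^{(−2)}` split multiplicative, `E[2]` irreducible:
  `ψ = χ_{−2}`, `𝔭' = ker(Λ → ℤ₂, σ ↦ κ(σ)^{−1}χ_{−2}(σ))` (T16 (a)(b)), `(κ^{−1}χ_{−2})(σ_{−1}) = (−1)(−1) = +1` (T16 (c)), so
  `σ_{−1} − 1 ∈ 𝔭'` and `𝔭' = 𝔭₊(𝔮')` for the height-one prime `𝔮' := 𝔭' ∩ Λ'` of `Λ'`, `2 ∉ 𝔮'`. In the coordinate of the
  readings (`Λ' = ℤ₂[[X]]`, `X = γ − 1`, `γ ↔ 5`, i.e. `γ` acts through `σ₅ ∈ U = 1 + 4ℤ₂`; T2/T11): `γ ↦ κ(σ₅)^{−1}χ_{−2}(σ₅) =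
  5^{−1}·(5, −2)₂ = −1/5` (Hilbert symbol: `(5,−2)₂ = (5,−1)₂(5,2)₂ = (+1)(−1)`; equivalently `σ₅ : ζ₈ ↦ ζ₈⁵ = −ζ₈` sends
  `√−2 = ζ₈ + ζ₈³` to `−√−2`), so `𝔮' = (X − a)` with `a = −1/5 − 1 = −6/5`, `v₂(a) = 1`. The local term of Thm. 12.5 (3) at
  `𝔭₊(𝔮')` has `length_{Λ_{𝔭'}} = 1` ((12.5.1)), and `Λ_{𝔭₊(𝔮')} = Λ'_{𝔮'} e₊ ≅ Λ'_{𝔮'}` (T3), so in T3's comparison at `𝔮'`: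
  `length_{𝔮'}(𝐇'²_{𝔮'}) ≤ length_{𝔮'}((𝐇'¹/Λ'z')_{𝔮'}) + 1`; at every OTHER height-one `𝔮 ∌ 2` the comparison is unchanged
  (`(Λ/𝔭')_{𝔭₊(𝔮)} = 0` for `𝔭₊(𝔮) ≠ 𝔭'`). [For `E^{(−1)}` split: `(5,−1)₂ = +1`, `a = 1/5 − 1 = −4/5`, `v₂(a) = 2`.]
* **T17 (b) (the count with one extra linear factor; T6/T6′ verbatim otherwise).** With `char(𝐇'²) = (2^{μ₂} g₀)`, `z' = 2^m φ₀ b`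
  as in T5–T6: T3 now gives `ord_𝔮(g₀) ≤ ord_𝔮(φ₀)` for `𝔮 ≠ 𝔮'` and `ord_{𝔮'}(g₀) ≤ ord_{𝔮'}(φ₀) + 1`, i.e. `g₀ ∣ φ₀·(X − a)` in the
  UFD `ℤ₂[[X]]` (both of `2`-adic content `0`; `X − a` is a distinguished polynomial since `a ∈ 2ℤ₂`). Lemma 14.15 / (★), (★★):
  `#H²(ℤ[1/2],T) = 2^{μ₂}|g₀(0)|₂^{−1}·#𝐇'²[X] ≤ 2^{μ₂}|φ₀(0)|₂^{−1}|a|₂^{−1}·#𝐇'²[X] = 2^{v₂(a)}·(the bound of T6)`; everything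
  downstream (T7/T7′, T8, T9, T10, T11–T14: `m ≥ 1`) is unchanged, so TOTAL
  `ord₂ #Ш(E/ℚ)[2^∞] + Σ_ℓ v₂(c_ℓ) ≤ ord₂(L(E,1)/Ω_E) + v₂(a) = ord₂(L(E,1)/Ω_E) + 1`. (T4′: the `2`-adic local term
  `H⁰(ℚ₂^cyc, E[2^∞])^∨` of the limit Poitou–Tate sequence is now `ℤ₂`-infinite — `μ_{2^∞} ⊗ χ_{−2}` is fixed by `Gal(ℚ̄₂/ℚ₂^cyc)`,
  on which `κ = χ_{−1}` and `χ_{−2}χ_{−1} = χ₂ = 1` — but `ℤ₂`-finitely generated, which is all T4′ uses: `μ(𝐇'²) = r_∞` under (A).)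
* **T17 (c) (the other cases under (NST″)).** If neither `E^{(−1)}` nor `E^{(−2)}` is split multiplicative, the APPEND fact gives the
  bound without `+ 1`, a fortiori with it. So under (NST″) alone: `… ≤ ord₂ q + 1`.

WHAT IS NOT CLAIMED. As before; in addition nothing for the curves with `E^{(−1)}` split multiplicative at `2` (`+ 2` only); the
sharp bound (without `+ 1`) for `E^{(−2)}` split is NOT claimed (BSD predicts it; the reading does not give it). Non-verbatim: T17
(a)(b) (elementary, on top of T3/T6/T16). Census (context): (NST″) holds on 294 of the 463 potentially multiplicative classes (224 with
irreducible `E[2]`), (NST′) on 255, (NST) on 219.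

THE LEAN STATEMENT. The APPEND fact with `d = -1 ∨ d = -2` replaced by `d = -1` and the conclusion `… ≤ padicValRat 2 q + 1`.
-/

namespace Literature.NumberTheory.EllipticCurves.Kato2004

open WeierstrassCurve

/-- **Kato's Euler-system bound at an ADDITIVE `2`, in analytic rank `0`, for IRREDUCIBLE `E[2]`, GRANTED statement (A) at `(E, 2)`,
under «the quadratic twist by `−1` is NOT split multiplicative at `2`» — with `+ 1`:
`ord₂ #Ш(E/ℚ)[2^∞] + v₂(∏_ℓ c_ℓ) ≤ ord₂(L(E,1)/Ω_E) + 1`.** The curves with `E^{(−2)}` split multiplicative at `2`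
(`E ≅ E_q ⊗ χ_{−2}` over `ℚ₂`) are now INCLUDED: there Kato's local term of **Thm. 12.5 (3)** sits (by **(12.5.1)** + **13.13**, T16) at
`𝔭' = ker(κ^{−1}χ_{−2})`, which IS a «`c = +1`» prime `𝔭₊(𝔮')` met by step T3 (`χ_{−2}(σ_{−1}) = −1`), with length `1`, and
`𝔮' = (X − a)`, `a = 5^{−1}(5,−2)₂ − 1 = −6/5`, `v₂(a) = 1`; the divisibility of T3/T6 becomes `g₀ ∣ φ₀·(X − a)` and Lemma 14.15
evaluates the extra factor at `X = 0` to `2^{v₂(a)} = 2` — the displayed `+ 1` (T17 (a)(b)); under the hypothesis the remaining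
curves satisfy (NST′) and the APPEND fact gives the bound even without `+ 1` (T17 (c)). For `E^{(−1)}` split (`a = −4/5`, `+ 2`)
nothing is claimed. Let `W/ℚ` be a globally minimal NON-CM elliptic curve with ADDITIVE reduction at `2` whose twist `W^{(−1)}` is
not split multiplicative at `2`, with `E[2]` irreducible, `L(E,1) ≠ 0`, `Ш(E/ℚ)` finite, and assume (`hA`) statement (A) at
`(E, 2)` in the `∃ γ D` spelling. Then there is `q ∈ ℚ` with `L(E,1)/Ω(W) = q` and `ord₂ #Ш(E/ℚ)(2) + v₂(Tam(W)) ≤ ord₂ q + 1`.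
A READING; never stronger than what the arguments give; no `_holds` (size XL). Flag for the referee:
`Kato-12.5(3)-(12.5.1)-13.13-T3-T6-at-two-additive-noSplitTwistNegOne-irreducible-fineSelmer-fg-plus-one`.
[cite: Kato2004Asterisque, Thm. 12.5 (1)(3) and (12.5.1) (pp. 221–222), 13.13 (pp. 233–234), 13.8 (pp. 227–229), 14.14 and Lemma 14.15 (pp. 243–244), Prop. 14.16 (2) (pp. 244–245)]
[cite: Kato1999Kodai, Thm. 0.8 (p. 318)]
[cite: SilvermanATAEC1994, Lemma V.5.2; Thm. V.5.3; proof of Cor. V.5.4 (p. 442); Exercise 5.11 (a)(b)(c)]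
[cite: SilvermanAEC2009, III.8, Prop. VII.5.1 (b), X.5 Cor. 5.4]
[cite: CoatesSujatha2005, statement (A) (introduction and §3)] [cite: Lim2017FineSelmer, §3]
[cite: Rubin2000, Ch. I §3 and Thm. I.7.3; Ch. III §5] -/
def rankZero_padicValNat_sha_add_padicValNat_tamagawa_le_add_one_at_two_of_noSplitTwistNegOne_of_irreducible_of_fineSelmerDual_fg :
    Prop :=
  ∀ (W : WeierstrassCurve ℚ) [W.IsElliptic] [W.IsGloballyMinimal], ¬ W.HasCM →
    ¬ W.HasGoodReductionAtPrime 2 → ¬ W.HasMultiplicativeReductionAtPrime 2 →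
    ¬ (W.quadraticTwist (-1)).HasSplitMultiplicativeReductionAtPrime 2 →
    W.HasIrreducibleModPGaloisRep 2 →
    (∀ (κ : ZpExtension ℚ 2), κ.IsCyclotomic →
      ∃ (γ : Field.absoluteGaloisGroup ℚ) (D : W.FineSelmerDualData κ γ),
        Module.Finite ℤ_[2] (RestrictScalars ℤ_[2] (IwasawaAlgebra 2) D.X)) →
    W.entireLFunction 1 ≠ 0 → Finite W.sha →
    ∃ q : ℚ, W.entireLFunction 1 / (W.realPeriodRat : ℂ) = (q : ℂ) ∧
      (padicValNat 2 (Nat.card (AddCommGroup.primaryComponent W.sha 2)) : ℤ) +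
          padicValNat 2 W.tamagawaProduct ≤ padicValRat 2 q + 1

end Literature.NumberTheory.EllipticCurves.Kato2004
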